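import Summits.Ventures.WeilGRH.ZetaFlatWindowSpectral
import Summits.Ventures.WeilGRH.TwistedWindowMeasureGrowth
import Summits.RiemannHypothesis.RiemannHypothesis.Theorems.WeilBochnerMeasureGramEntries
import HarnessLib

/-!
# rh-explicit (venture WeilGRH): THE DIAGONAL OF YOSHIDA'S GRAM MATRIX BOUNDS THE SPECTRAL MASS AT THE
  LATTICE HEIGHTS `πn/a` — under RH, `2a · ord_{s=½−iπn/a} ζ(s) ≤ G_a(n, n)`

Cell `rh-explicit`, WEIL TRACK (structure seat weil-3, gen9).  The `ζ` counterpart of `FlatWindowAtoms.lean`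
(one rung bounds the spectral mass at every height), in FORMAT-C vocabulary: Yoshida's basis function
`χ_n = (2a)^{-1/2} e^{πinx/a} 𝟙_{[-a,a]}` is the flat window modulated by `θ = πn/a`, its transform is the
Fejér/sinc profile centred at `−πn/a` with full value `‖χ̂_n(½ − iπn/a)‖² = 2a`, and by the structure
seat's `WeilBochnerMeasureGramEntries.gramCoeff_eq_integral` (gen4) the diagonal Gram entry is
`G_a(n,n) = ∫ ‖χ̂_n(½+it)‖² dμ` for every measure `μ` representing Weil's form on `[-a, a]`.  Hence:

* `chi_eq_modulate_chi_zero`, `weilMellin_chi` (`χ̂_n(½+it) = χ̂_0(½+i(t+πn/a))`),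
  `norm_sq_weilMellin_chi_peak` (`= 2a` at `t = −πn/a`);
* **`two_mul_mul_atom_le_gramCoeff`** (RH-free): for every `a > 0`, `n ∈ ℤ` and every positive `μ`
  representing Weil's form on the tests of `[-a, a]`: **`2a · μ{−πn/a} ≤ gramCoeff a n n`** — the
  certified format-C Gram diagonals (EXTREMALS/) are upper bounds for spectral atoms at the lattice heights;
* `zetaZeroHeightMeasure_singleton_of_riemannHypothesis`: under RH, `ν_ζ{τ} = ord_{s=½+iτ} ζ(s)`;
* **`two_mul_mul_zetaZeroOrder_le_gramCoeff`**: RH ⟹ `2a · ord_{s=½+iτ} ζ ≤ gramCoeff a n n` whenever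
  `τ = −πn/a` — a multiplicity CERTIFICATE for an individual zero from ONE Gram entry (choose `a = π|n|/|τ|`;
  for `a ≤ (log 2)/2` the entry is prime-free).

No definitions, no named facts; RH only where named.
-/

set_option autoImplicit false

noncomputable section

open Complex Filter Set MeasureTheory
open scoped Real Topology ComplexConjugate ArithmeticFunction.vonMangoldt

namespace Summit.Ventures.WeilGRH

open Literature.NumberTheory.LFunctions
open Literature.NumberTheory.LFunctions.Yoshida1992 (chi chiCore gramCoeff)
open Literature.NumberTheory.LFunctions.WeilBochner (zetaZeroHeightMeasure)
open Literature.NumberTheory.LFunctions.ZetaZeros (riemannZetaNontrivialZeros)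
open Summit.RiemannHypothesis.RiemannHypothesis.Theorems.WeilFormatC
open Summit.RiemannHypothesis.RiemannHypothesis.Theorems.WeilBochnerMeasure (gramCoeff_eq_integral
  integrable_inv_one_add_sq)

variable {a : ℝ}

/-! ## Yoshida's `χ_n` is the modulated flat window -/

/-- `χ_n(x) = e^{i(πn/a)x} χ_0(x)`. -/
theorem chi_eq_modulate_chi_zero (a : ℝ) (n : ℤ) :
    chi a n = fun x ↦ cexp (I * ((π * n / a) * x : ℝ)) * chi a 0 x := by
  funext x
  by_cases hx : x ∈ Icc (-a) a
  · rw [chi_apply_of_mem n hx, chi_apply_of_mem 0 hx]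
    simp only [Int.cast_zero, mul_zero, zero_mul, zero_div, Complex.exp_zero, mul_one]
    rw [mul_comm]
    congr 1
    push_cast
    ring_nf
  · rw [chi_apply_of_not_mem n hx, chi_apply_of_not_mem 0 hx, mul_zero]

/-- **`χ̂_n(½+it) = χ̂_0(½+i(t+πn/a))`**: the transform of the `n`-th basis function is the flat window's
sinc shifted by `−πn/a`. -/
theorem weilMellin_chi (a : ℝ) (n : ℤ) (t : ℝ) :
    weilMellin (chi a n) (1 / 2 + t * I) = weilMellin (chi a 0) (1 / 2 + ((t + π * n / a : ℝ) : ℂ) * I) := by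
  rw [chi_eq_modulate_chi_zero, weilMellin_modulate]

/-- **Peak value**: `‖χ̂_n(½ − iπn/a)‖² = 2a` (`a > 0`). -/
theorem norm_sq_weilMellin_chi_peak (ha : 0 < a) (n : ℤ) :
    ‖weilMellin (chi a n) (1 / 2 + ((-(π * n / a) : ℝ) : ℂ) * I)‖ ^ 2 = 2 * a := by
  rw [weilMellin_chi, show -(π * n / a) + π * n / a = (0 : ℝ) by ring, norm_sq_weilMellin_chi_zero_zero ha]

/-! ## The Gram diagonal bounds the atoms at the lattice heights -/

/-- **THE GRAM DIAGONAL BOUNDS THE SPECTRAL MASS AT THE LATTICE HEIGHTS** (RH-free).  For `a > 0`, `n ∈ ℤ`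
and every positive measure `μ` representing Weil's form on the tests of `[-a, a]`:

  `2a · μ{−πn/a} ≤ gramCoeff a n n`

(`gramCoeff a n n = ∫ ‖χ̂_n(½+it)‖² dμ ≥ ∫_{{−πn/a}} = 2a · μ{−πn/a}`). -/
theorem two_mul_mul_atom_le_gramCoeff (ha : 0 < a) {μ : Measure ℝ}
    (hμ : ∀ g : ℝ → ℂ, IsWeilTest g → tsupport g ⊆ Icc (-a) a →
      Integrable (fun t : ℝ ↦ ‖weilMellin g (1 / 2 + t * I)‖ ^ 2) μ ∧
        weilQuadratic g = ((∫ t, ‖weilMellin g (1 / 2 + t * I)‖ ^ 2 ∂μ : ℝ) : ℂ)) (n : ℤ) :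
    2 * a * μ.real {-(π * n / a)} ≤ gramCoeff a n n := by
  obtain ⟨hint, heq⟩ := gramCoeff_eq_integral ha hμ n n
  have hI := integrable_inv_one_add_sq ha hμ
  have h0 := measure_singleton_lt_top_of_integrable hI (-(π * n / a))
  set τ : ℝ := -(π * n / a) with hτ
  have hsq : ∀ t : ℝ, (weilMellin (chi a n) (1 / 2 + t * I) * conj (weilMellin (chi a n) (1 / 2 + t * I))).re =
      ‖weilMellin (chi a n) (1 / 2 + t * I)‖ ^ 2 := fun t ↦ by
    rw [Complex.mul_conj, Complex.ofReal_re, Complex.normSq_eq_norm_sq]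
  simp_rw [hsq] at hint heq
  have hind : Integrable (fun t : ℝ ↦ ({τ} : Set ℝ).indicator (fun _ ↦ 2 * a) t) μ :=
    (integrable_indicator_iff (measurableSet_singleton τ)).2 (integrableOn_const h0.ne)
  have hle : ∀ t : ℝ, ({τ} : Set ℝ).indicator (fun _ ↦ 2 * a) t ≤ ‖weilMellin (chi a n) (1 / 2 + t * I)‖ ^ 2 := by
    intro t
    by_cases ht : t ∈ ({τ} : Set ℝ)
    · rw [indicator_of_mem ht, mem_singleton_iff.1 ht, hτ, norm_sq_weilMellin_chi_peak ha]
    · rw [indicator_of_notMem ht]; positivity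
  calc 2 * a * μ.real {τ} = ∫ t, ({τ} : Set ℝ).indicator (fun _ ↦ 2 * a) t ∂μ := by
        rw [integral_indicator_const _ (measurableSet_singleton τ), smul_eq_mul, mul_comm]
    _ ≤ ∫ t, ‖weilMellin (chi a n) (1 / 2 + t * I)‖ ^ 2 ∂μ := integral_mono hind hint hle
    _ = gramCoeff a n n := heq.symm

/-! ## Under RH: multiplicity certificates from one Gram entry -/

/-- Under RH the atoms of `ν_ζ` are the multiplicities: `ν_ζ{τ} = ord_{s=½+iτ} ζ(s)` (as a natural number;
`0` if `½+iτ` is not a zero). -/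
theorem zetaZeroHeightMeasure_singleton_of_riemannHypothesis (hRH : RiemannHypothesis) (τ : ℝ) :
    zetaZeroHeightMeasure {τ} = ((riemannZetaZeroOrder (1 / 2 + τ * I)).toNat : ENNReal) := by
  classical
  rw [zetaZeroHeightMeasure, Measure.sum_apply _ (measurableSet_singleton τ)]
  simp only [Measure.smul_apply, smul_eq_mul]
  -- under RH a non-trivial zero with ordinate `τ` is `½ + iτ`
  have hhalf : ∀ ρ : riemannZetaNontrivialZeros, (ρ : ℂ).im = τ → (ρ : ℂ) = 1 / 2 + τ * I := by
    intro ρ him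
    have hρ := ρ.2
    have hre : (ρ : ℂ).re = 1 / 2 := by
      refine hRH _ (ZetaZeros.riemannZetaNontrivialZeros.zeta_eq_zero hρ) ?_
        (ZetaZeros.riemannZetaNontrivialZeros.ne_one hρ)
      rintro ⟨k, hk⟩
      have h0 := ZetaZeros.riemannZetaNontrivialZeros.re_pos hρ
      have e : (-2 * ((k : ℂ) + 1)).re = -2 * ((k : ℝ) + 1) := by simp
      rw [hk, e] at h0
      have : (0 : ℝ) ≤ k := k.cast_nonneg
      linarith
    apply Complex.ext <;> simp [hre, him]
  by_cases hmem : (1 / 2 + τ * I : ℂ) ∈ riemannZetaNontrivialZeros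
  · rw [tsum_eq_single ⟨1 / 2 + τ * I, hmem⟩]
    · simp [Measure.dirac_apply' _ (measurableSet_singleton τ)]
    · intro ρ hρ
      have him : (ρ : ℂ).im ≠ τ := fun h ↦ hρ (Subtype.ext (hhalf ρ h))
      rw [Measure.dirac_apply' _ (measurableSet_singleton τ), indicator_of_notMem (by simpa using him),
        mul_zero]
  · -- not a zero: the order is `≤ 0`, its `toNat` is `0`, and no `ρ` has ordinate `τ`
    have hzero : (riemannZetaZeroOrder (1 / 2 + τ * I)).toNat = 0 := by
      have h1 : (1 / 2 + τ * I : ℂ) ≠ 1 := by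
        intro h; have := congrArg Complex.re h; norm_num at this
      by_contra h
      have hpos : 0 < riemannZetaZeroOrder (1 / 2 + τ * I) := by
        have := Int.toNat_eq_zero.not.1 h
        omega
      rw [riemannZetaZeroOrder_pos_iff h1] at hpos
      refine hmem ?_
      rw [ZetaZeros.riemannZetaNontrivialZeros.mem_iff']
      exact ⟨hpos, by norm_num, by norm_num⟩
    rw [hzero, Nat.cast_zero]
    refine ENNReal.tsum_eq_zero.2 fun ρ ↦ ?_
    have him : (ρ : ℂ).im ≠ τ := fun h ↦ hmem ((hhalf ρ h) ▸ ρ.2)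
    rw [Measure.dirac_apply' _ (measurableSet_singleton τ), indicator_of_notMem (by simpa using him), mul_zero]

/-- **RH ⟹ A MULTIPLICITY CERTIFICATE FROM ONE GRAM ENTRY.**  If the Riemann hypothesis holds, then for every
`a > 0` and `n ∈ ℤ`:

  `2a · ord_{s = ½ − iπn/a} ζ(s) ≤ gramCoeff a n n`

— the diagonal entry of Yoshida's Gram matrix at window `a` (a certified, explicit number in the format-C
archives; prime-free for `a ≤ (log 2)/2`) bounds the multiplicity of the zero at height `−πn/a`.  For a
given zero `½ + iγ` take `a = π|n|/|γ|`. -/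
theorem two_mul_mul_zetaZeroOrder_le_gramCoeff (hRH : RiemannHypothesis) (ha : 0 < a) (n : ℤ) :
    2 * a * ((riemannZetaZeroOrder (1 / 2 + ((-(π * n / a) : ℝ) : ℂ) * I)).toNat : ℝ) ≤ gramCoeff a n n := by
  have h := two_mul_mul_atom_le_gramCoeff ha
    (fun g hg _ ↦ WeilBochner.weilQuadratic_eq_integral_of_riemannHypothesis hRH hg) n
  rwa [measureReal_def, zetaZeroHeightMeasure_singleton_of_riemannHypothesis hRH, ENNReal.toReal_natCast] at h

end Summit.Ventures.WeilGRH
-- Build note (weil-3 gen13, 2026-08-24): byte-identical re-land under lead ruling R14-3 (APPEND REMEDY) to trigger the hub build; p366463 accepted 2026-08-23T14:21Z.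
end
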